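import Summits.ABC.IUTFork.Joshi.ATS4ReductionBridge
import Literature.IUT.HodgeTheaters.InitialThetaDataConditions
import Literature.NumberTheory.DiophantineGeometry.AbcWave0UniformABCProofs
import HarnessLib

/-!
# [J-IV] Prop. 4.1.1 (1)–(2) at Mochizuki's `F_mod`-model: they FAIL above `2` whenever `|j_λ|_2 > 1`
# (kernel note on the registry row J4:Prop4.1.1; PROOF-ONLY, no definition, nothing asserted)

Proof-only file of the abc-iut cell, block E «type Joshi's construction, test vs S» (rung LADDER-ABC:A2.E; seat abc-iut-E-t28,
reader-companion on the EXISTING registry row J4:Prop4.1.1 typed by E-t26 in `Joshi/ATS4Differents.lean` p430056 and read on a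
genuine curve by E-t6 in `Joshi/ATS4ReductionBridge.lean` p432257; announced on STATUS with first refusal to the row owner).
SOURCE (own reading of the cell's render `HOME/lit/renders/Joshi-arxiv-2403.10430/pNNNN.txt`): K. Joshi, *Construction of
Arithmetic Teichmüller Spaces IV*, arXiv:2403.10430v2 («Preliminary version for comments», UNREFEREED) = [J-IV], Prop. 4.1.1
p.38 l.12–24: «The assumptions Initial Theta Data [Joshi, 2024c, § 2.4, § 3.1, § 3.3] and § 4.1.1, § 4.1.2 are in force. Let `v ∈
V^non_L`. Then (1) `C/L` has semistable reduction at `v` if and only if `v ∈ V^{odd,ss}`. (2) `C/L` has good or additive reduction if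
`v ∈ {w ∈ V_L : w | (2ℓ)}`. (3) `C/L` has good reduction at `v ∉ (V^{odd,ss} ∪ {w ∈ V_L : w | (2ℓ)})`. Proof. This is clear from §
4.1.1, § 4.1.2 and Initial Theta Data». TAKES NO SIDE on [IUTchIII] Cor. 3.12, on the claims of K. Joshi, or on S. Mochizuki's
reports on them; typed ≠ proved ≠ endorsed; NO abc claim. CLASSICAL arithmetic of the `λ`-line only.

## What is proved (numbers, not adjectives)

At the `F_mod`-model of a point `λ ∈ U_P` of the `λ`-line — the object about which [J-IV] Thm. 5.7.1 (= «my formulation of [IUTchIV]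
Cor. 2.2 (i,ii)») is PROVED in the tree (`thm571Mod_holds` p433999; with the clause «and §4.1.1, §4.1.2 with the prime `ℓ`»,
`thm571Mod412_holds` p439722): `L := F = F_mod(√−1, W[2·3·5])` (`FTheta λ`), `C := E_F = W ⊗ F` (`ETheta λ`), `W` the `F_mod =
ℚ(j_λ)`-model — suppose `F_tpd = ℚ(λ)` has a place `v` over `2` with `ord_v(j_λ) < 0` (i.e. `|j_λ|_v > 1`). Then for EVERY `ℓ`:

* `hasMultiplicativeReductionAt_model_of_liesOver` — every place `w | v` of `F` is a place of bad MULTIPLICATIVE reduction of `E_F` (`E_F`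
  is semistable, the tree's `modelCurve_isSemistable`; `ord_w j(E_F) = e(w|v)·ord_v j_λ < 0`, the tree's `ord_modelJ_eq_mul`;
  `hasMultiplicativeReductionAt_of_ord_j_neg`), and `w` has residue characteristic `2` (`residueChar_model_eq_two_of_liesOver`);
* `not_prop411_1_model` — Prop. 4.1.1 (1) FAILS for `ReductionDatum.ofCurve (ETheta λ) ℓ` (a multiplicative place of EVEN residue
  characteristic is not in `V^{odd,ss}`); `not_prop411_2_model` — Prop. 4.1.1 (2) FAILS (a place over `2` divides `2ℓ` and is neither
  good nor additive); hence `not_prop411_model : ¬ Prop411`.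
* `not_prop411_model_thirtyTwo` — a GENUINE instance: `λ = 32 ∈ ℚ` (`j_32 = 993³/(2²·31²)`, `ord_2 j_32 < 0`), for every `ℓ`.

Meanwhile at the same model §4.1.1 (1) and §4.1.2 (6)–(9) HOLD (`goodReductionHyp_model`, `hyp411412Mod_of_mem_UP`, p439722) and
Joshi's [J-III] §3.1 + §3.3 structure `ATS3.InitialThetaData` is INHABITED off a finite `Exc` (`thm571Mod_holds`, p433999; E-t6's
`ATS3.InitialThetaData.nonempty_at`), none of whose clauses constrains the reduction of `C` above `2` ([J-III] Lem. 3.2.1 (2), p.27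
l.35–37, says so explicitly: «for any `w | 2` in `V^good_{L_mod}`, `X` can have good or bad (additive or multiplicative) reduction at
`w`»). LOCATED CONSEQUENCE: the printed proof of Prop. 4.1.1 («clear from § 4.1.1, § 4.1.2 and Initial Theta Data») does not cover
parts (1)–(2) at the places over `2` (nor, by the same mechanism, over `ℓ` when `E_F` is bad above `ℓ`, which [IUTchIV] (P3) «if `l
= p_v` then `h_v < h^{1/2}`» allows); hypothesis (5.6.2) = [IUTchIV] (∗^{j-inv}) only BOUNDS `|j|_2` on `Z_2` and does not exclude
`|j_λ|_2 > 1`; [IUTchIV] Cor. 2.2 never claims (1)–(2) (it controls the places over `2` through (∗^{j-inv})). Whether [J-IV] USES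
(1)–(2) downstream (Lem. 4.1.4 «immediate from Proposition 4.1.1») is for the referee lane; not adjudicated here.

[claim: Joshi2024ATS4, status: disputed] (unrefereed preprint); [claim: Joshi2024ATS3, status: disputed]; [claim: Mochizuki2012,
status: disputed] for the [IUTchIV] decls cited BY NAME. DEFS-FREEZE respected; no `Cor312*` / `Thm311*` import (E-PLAN R14);
no new `Prop` fact; standard axioms only.
-/

noncomputable section

open scoped Classical
open NumberField IsDedekindDomain
open Literature.NumberTheory.DiophantineGeometry Literature.NumberTheory.DiophantineGeometry.GenEll
open Literature.IUT.LogVolume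
open Literature.IUT.HodgeTheaters hiding InitialThetaData residueChar

namespace Summit.ABC.IUTFork.Joshi.ATS4

/-! ## The places of `F` over a place of `F_tpd` where `|j_λ| > 1` -/
section AboveBad

variable (P : NFPoint)

/-- Over a place `v` of `F_tpd = ℚ(λ)` with `ord_v(j_λ) < 0`, every place `w` of `F = F_mod(√−1, W[30])` lying over `v` (through the
tree's embedding `F_tpd ↪ F`, `tpdAlgebra`) is a place of bad MULTIPLICATIVE reduction of `E_F = W ⊗ F`: `E_F` is semistable
(`modelCurve_isSemistable`) and `ord_w j(E_F) = e(w|v)·ord_v j_λ < 0` (`ord_modelJ_eq_mul`). PROVED (the argument of the tree's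
`nonempty_badSet_of_condP5`, without the condition `v ∤ 2l`). [claim: Mochizuki2012, status: disputed] -/
theorem hasMultiplicativeReductionAt_model_of_liesOver (hP : P ∈ UP) (v : HeightOneSpectrum (𝓞 P.F))
    (hvj : ord P.F v (Cor22.jInv P.x) < 0) (w : HeightOneSpectrum (𝓞 (FTheta P))) :
    letI := tpdAlgebra P hP
    w.asIdeal.LiesOver v.asIdeal → (ETheta P).HasMultiplicativeReductionAt w := by
  letI := tpdAlgebra P hP
  intro hwv
  have he0 : v.asIdeal.ramificationIdx' w.asIdeal ≠ 0 :=
    Ideal.IsDedekindDomain.ramificationIdx'_ne_zero_of_liesOver w.asIdeal v.ne_bot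
  have hord : ord (FTheta P) w (ETheta P).j < 0 := by
    rw [ord_modelJ_eq_mul P hP v w hwv]
    exact mul_neg_of_pos_of_neg (by exact_mod_cast Nat.pos_of_ne_zero he0) hvj
  exact hasMultiplicativeReductionAt_of_ord_j_neg (ETheta P) (modelCurve_isSemistable (modCurve P)) hord

/-- A place `w` of `F` over a place `v | 2` of `F_tpd` has residue characteristic `p_w = 2` (`2 ∈ 𝔭_v ⊆ 𝔭_w`, and `p_w` is the prime
with `(p_w) = 𝔭_w ∩ ℤ`). PROVED. [cite: NeukirchANT1999, Ch. I (8.2)] -/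
theorem residueChar_model_eq_two_of_liesOver (hP : P ∈ UP) (v : HeightOneSpectrum (𝓞 P.F))
    (hv2 : ((2 : ℕ) : 𝓞 P.F) ∈ v.asIdeal) (w : HeightOneSpectrum (𝓞 (FTheta P))) :
    letI := tpdAlgebra P hP
    w.asIdeal.LiesOver v.asIdeal → Literature.IUT.LogVolume.residueChar (FTheta P) w = 2 := by
  letI := tpdAlgebra P hP
  intro hwv
  have h2w : ((2 : ℕ) : 𝓞 (FTheta P)) ∈ w.asIdeal := by
    have h : ((2 : ℕ) : 𝓞 P.F) ∈ w.asIdeal.under (𝓞 P.F) := by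
      rwa [← Ideal.LiesOver.over (P := w.asIdeal) (p := v.asIdeal)]
    rw [Ideal.mem_comap, map_natCast] at h
    exact h
  have hdvd : Literature.IUT.LogVolume.residueChar (FTheta P) w ∣ 2 :=
    (Literature.NumberTheory.NumberFields.natCast_mem_iff_absNorm_under_dvd (FTheta P) w.asIdeal 2).1 h2w
  exact (Nat.prime_dvd_prime_iff_eq (residueChar_prime (FTheta P) w) Nat.prime_two).1 hdvd

/-- There is a place of `F` over any place `v` of `F_tpd` (`𝓞_F` is an integral extension of `𝓞_{F_tpd}`; Mathlib
`Ideal.primesOver` is nonempty). PROVED. [cite: NeukirchANT1999, Ch. I (8.2)] -/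
theorem exists_liesOver_model (hP : P ∈ UP) (v : HeightOneSpectrum (𝓞 P.F)) :
    letI := tpdAlgebra P hP
    ∃ w : HeightOneSpectrum (𝓞 (FTheta P)), w.asIdeal.LiesOver v.asIdeal := by
  letI := tpdAlgebra P hP
  haveI : v.asIdeal.IsMaximal := v.isMaximal
  obtain ⟨⟨Pw, hPw⟩⟩ := (inferInstance : Nonempty (Ideal.primesOver v.asIdeal (𝓞 (FTheta P))))
  haveI : Pw.IsPrime := hPw.1
  haveI : Pw.LiesOver v.asIdeal := hPw.2
  exact ⟨⟨Pw, hPw.1, Ideal.ne_bot_of_liesOver_of_ne_bot v.ne_bot Pw⟩, hPw.2⟩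

end AboveBad

/-! ## Prop. 4.1.1 (1) and (2) FAIL at the model when `|j_λ|_2 > 1` -/
section Prop411

variable {P : NFPoint}

/-- **[J-IV] Prop. 4.1.1 (1) FAILS at the `F_mod`-model** of a point `λ ∈ U_P` having a place `v | 2` of `F_tpd` with `ord_v(j_λ) < 0`,
for EVERY `ℓ`: a place `w | v` of `F` is a multiplicative («semistable» in Joshi's sense) place of `E_F` of EVEN residue
characteristic, so `w ∉ V^{odd,ss}` — in E-t26's typing read through E-t6's `ReductionDatum.ofCurve` (`prop411_1_ofCurve_iff`: (1) ⟺
every multiplicative place has odd residue characteristic). PROVED. [claim: Joshi2024ATS4, status: disputed] -/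
theorem not_prop411_1_model (hP : P ∈ UP) (v : HeightOneSpectrum (𝓞 P.F)) (hv2 : ((2 : ℕ) : 𝓞 P.F) ∈ v.asIdeal)
    (hvj : ord P.F v (Cor22.jInv P.x) < 0) (ℓ : ℕ) : ¬ (ReductionDatum.ofCurve (ETheta P) ℓ).Prop411_1 := by
  rw [ReductionDatum.prop411_1_ofCurve_iff]
  intro h
  obtain ⟨w, hwv⟩ := exists_liesOver_model P hP v
  have hodd := h w (hasMultiplicativeReductionAt_model_of_liesOver P hP v hvj w hwv)
  rw [residueChar_model_eq_two_of_liesOver P hP v hv2 w hwv] at hodd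
  exact (Nat.not_odd_iff_even.mpr even_two) hodd

/-- **[J-IV] Prop. 4.1.1 (2) FAILS at the `F_mod`-model** of such a point, for EVERY `ℓ`: a place `w | v | 2` of `F` divides `2ℓ` and is
a place of bad multiplicative reduction of `E_F`, neither good nor additive (`prop411_2_ofCurve_iff`: (2) ⟺ no multiplicative place
divides `2ℓ`). PROVED. [claim: Joshi2024ATS4, status: disputed] -/
theorem not_prop411_2_model (hP : P ∈ UP) (v : HeightOneSpectrum (𝓞 P.F)) (hv2 : ((2 : ℕ) : 𝓞 P.F) ∈ v.asIdeal)
    (hvj : ord P.F v (Cor22.jInv P.x) < 0) (ℓ : ℕ) : ¬ (ReductionDatum.ofCurve (ETheta P) ℓ).Prop411_2 := by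
  rw [ReductionDatum.prop411_2_ofCurve_iff]
  intro h
  obtain ⟨w, hwv⟩ := exists_liesOver_model P hP v
  refine h w ?_ (hasMultiplicativeReductionAt_model_of_liesOver P hP v hvj w hwv)
  rw [residueChar_model_eq_two_of_liesOver P hP v hv2 w hwv]
  exact dvd_mul_right 2 ℓ

/-- Hence **[J-IV] Prop. 4.1.1 (the conjunction (1) ∧ (2) ∧ (3), E-t26's claim `Prop411`) FAILS at the `F_mod`-model** of such a point for
every `ℓ` — although part (3) = §4.1.1 (1) HOLDS there (`goodReductionHyp_model`, p439722). PROVED. [claim: Joshi2024ATS4, status: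
disputed] -/
theorem not_prop411_model (hP : P ∈ UP) (v : HeightOneSpectrum (𝓞 P.F)) (hv2 : ((2 : ℕ) : 𝓞 P.F) ∈ v.asIdeal)
    (hvj : ord P.F v (Cor22.jInv P.x) < 0) (ℓ : ℕ) : ¬ (ReductionDatum.ofCurve (ETheta P) ℓ).Prop411 :=
  fun h => not_prop411_1_model hP v hv2 hvj ℓ h.1

end Prop411

/-! ## A genuine instance: `λ = 32 ∈ ℚ` -/
section ThirtyTwo

/-- A natural number prime to the prime under a place `v` of `ℚ` has `ord_v = 0`. [folklore] -/
private theorem ord_natCast_eq_zero_of_not_dvd (v : HeightOneSpectrum (𝓞 ℚ)) {n : ℕ}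
    (h : ¬ Rat.HeightOneSpectrum.natGenerator v ∣ n) : ord ℚ v (n : ℚ) = 0 := by
  unfold ord
  rw [(UniformABCConjecture.valuation_natCast_eq_one_iff v n).2 h, WithZero.log_one, neg_zero]

/-- A nonzero natural number divisible by the prime under `v` has `ord_v > 0`. [folklore] -/
private theorem ord_natCast_pos_of_dvd (v : HeightOneSpectrum (𝓞 ℚ)) {n : ℕ} (hn : n ≠ 0)
    (h : Rat.HeightOneSpectrum.natGenerator v ∣ n) : 0 < ord ℚ v (n : ℚ) := by
  have hmem : (n : 𝓞 ℚ) ∈ v.asIdeal := (UniformABCConjecture.natCast_mem_asIdeal_iff v n).2 h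
  have hne : (n : 𝓞 ℚ) ≠ 0 := by exact_mod_cast hn
  simpa using (ord_pos_iff_mem ℚ v _ hne).2 hmem

/-- `j_32 = 2⁸·(32² − 32 + 1)³ / (32²·31²) = 993³ / 3844` (`3844 = 2²·31²`). PROVED. [folklore] -/
theorem jInv_thirtyTwo : Cor22.jInv (32 : ℚ) = ((993 ^ 3 : ℕ) : ℚ) / ((3844 : ℕ) : ℚ) := by
  unfold Cor22.jInv
  push_cast
  norm_num

/-- At the place of `ℚ` over `2`, `ord_2(j_32) < 0` (`2 ∤ 993³`, `2 ∣ 3844`). PROVED. [folklore] -/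
theorem ord_jInv_thirtyTwo_neg (v : HeightOneSpectrum (𝓞 ℚ)) (hv : Rat.HeightOneSpectrum.natGenerator v = 2) :
    ord ℚ v (Cor22.jInv (32 : ℚ)) < 0 := by
  have hA := ord_natCast_eq_zero_of_not_dvd v (n := 993 ^ 3) (by rw [hv]; norm_num)
  have hB := ord_natCast_pos_of_dvd v (n := 3844) (by norm_num) (by rw [hv]; norm_num)
  have hA0 : ((993 ^ 3 : ℕ) : ℚ) ≠ 0 := by positivity
  have hB0 : ((3844 : ℕ) : ℚ) ≠ 0 := by positivity
  rw [jInv_thirtyTwo, div_eq_mul_inv, ord_mul ℚ v hA0 (inv_ne_zero hB0), ord_inv, hA]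
  omega

/-- `λ = 32` is a point of `U_P` (presented over `ℚ`, minimally). PROVED. [folklore] -/
theorem ratPoint_thirtyTwo_mem_UP : ratPoint 32 ∈ UP :=
  (ratPoint_mem_UPle_one (q := 32) (by norm_num) (by norm_num)).1

/-- **Genuine instance**: at the `F_mod`-model of `λ = 32` (`F_tpd = F_mod = ℚ`, `W` the `ℚ`-model with `j = 993³/3844`, `F = ℚ(√−1,
W[30])`, `E_F = W ⊗ F`), [J-IV] Prop. 4.1.1 (1) and (2) FAIL for EVERY `ℓ`: `E_F` is multiplicative at every place of `F` over `2`.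
(The point `λ = 32` has `|λ|_2 = 2^{−5}`, `|j_32|_2 = 4`; compactly bounded sets `Z` with `2 ∈ S` and (5.6.2) containing such points
exist — (5.6.2) asks only `Z_2 ⊂ 2^{N}·O_{Q̄_2}` for SOME `N ∈ ℤ`.) PROVED. [claim: Joshi2024ATS4, status: disputed] -/
theorem not_prop411_model_thirtyTwo (ℓ : ℕ) :
    ¬ (ReductionDatum.ofCurve (ETheta (ratPoint 32)) ℓ).Prop411_1 ∧
      ¬ (ReductionDatum.ofCurve (ETheta (ratPoint 32)) ℓ).Prop411_2 := by
  obtain ⟨v, hv⟩ : ∃ v : HeightOneSpectrum (𝓞 ℚ), Rat.HeightOneSpectrum.natGenerator v = 2 :=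
    ⟨(Rat.HeightOneSpectrum.primesEquiv (R := 𝓞 ℚ)).symm ⟨2, Nat.prime_two⟩,
      congrArg Subtype.val ((Rat.HeightOneSpectrum.primesEquiv (R := 𝓞 ℚ)).apply_symm_apply ⟨2, Nat.prime_two⟩)⟩
  have hv2 : ((2 : ℕ) : 𝓞 ℚ) ∈ v.asIdeal :=
    (UniformABCConjecture.natCast_mem_asIdeal_iff v 2).2 (by rw [hv])
  have hvj : ord ℚ v (Cor22.jInv (32 : ℚ)) < 0 := ord_jInv_thirtyTwo_neg v hv
  exact ⟨not_prop411_1_model (P := ratPoint 32) ratPoint_thirtyTwo_mem_UP v hv2 hvj ℓ,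
    not_prop411_2_model (P := ratPoint 32) ratPoint_thirtyTwo_mem_UP v hv2 hvj ℓ⟩

end ThirtyTwo

end Summit.ABC.IUTFork.Joshi.ATS4

end
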